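import Summits.Ventures.PercRepro.C025ProfilePLDUniformTable_r5_s5_m9
import Summits.Ventures.PercRepro.C025ProfilePLDFiveLiftArith
import Summits.Ventures.PercRepro.C025ProfilePLDFiveTable5a
import Summits.Ventures.PercRepro.C025ProfilePLDFiveTable5b
import Summits.Ventures.PercRepro.C025ProfilePLDFiveTable5c

/-!
# (PLD) FOR «M ⊕ U_{5,m}» FOR EVERY m ≥ 9 AND EVERY (PLD)-MATROID M OF RANK ≤ 5: THE CERTIFICATE TABLE FOR U_{5,9} LIFTED IN m (night-3 g32)

`proofs/NIGHT3-G32-MATCHING.md` §6.  The profile of `U_{5,m}` is `T₀₅ + m·T₁₅ + C(m,2)·T₂₅ + C(m,3)·T₃₅ + C(m,4)·T₄₅ + c_m·δ₅₅`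
(`PLDFiveLift.sum_choose_min_five`, `m ≥ 9`); `T₄₅` and `δ₅₅` preserve PER-LAYER DOMINANCE (g29), the joint-LP preservers
`q₅ = T₁₅ + 3·T₂₅ + 5·T₃₅ + 7·T₄₅`, `q₅′ = T₂₅ + 2·T₃₅ + 3·T₄₅`, `q₅″ = T₃₅ + 2·T₄₅` do at rank ≤ 5
(`PLDPlaneTable.pld_conv_q51_of_eRank_le_5`, `pld_conv_q52_of_eRank_le_5`, `pld_conv_q53_of_eRank_le_5`), and
`24·(U_{5,9+k} − U_{5,9}) = 24k·q₅ + 12k(11+k)·q₅′ + 4k(95+18k+k²)·q₅″ + k(k³+22k²+155k+326)·T₄₅ + 24(c_{9+k} − c₉)·δ₅₅`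
(`lift_instance_five`): ONE certificate table — the landed `uniform_5_9_table_5` for `M ⊕ U_{5,9}` at rank ≤ 5 — gives (PLD) for
`M ⊕ U_{5,m}` for EVERY `m ≥ 9` (`pld_disjointSum_uniform_five_ge_9_of_eRank_le_5`).  No `def`, no `instance`, no notation.  Axioms: standard.
-/

open scoped Matroid

namespace PercRepro

open Finset ThmH

namespace PLDFiveLift

variable {α : Type} [DecidableEq α]

/-- (PLD) FOR «M ⊕ U_{5,m}» FOR EVERY `m ≥ 9` AND EVERY (PLD)-MATROID `M` OF RANK ≤ 5: the uniform matroid is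
`truncate (freeOn F) 5` with `|F| = m ≥ 9`. -/
theorem pld_disjointSum_uniform_five_ge_9_of_eRank_le_5 (M : Matroid α) [M.Finite] (hr : M.eRank ≤ 5)
    (hPLD : ∀ lo hi δ Θ : ℕ, Θ ≤ lo + hi + δ → (lo = 0 ∨ lo + hi + δ ≤ Θ) →
      (∑ I ∈ (gr M).powerset, (if lo ≤ (M.eRk (I : Set α)).toNat ∧ (M.eRk (I : Set α)).toNat ≤ hi ∧
          Θ ≤ (M.eRk ((gr M \ I : Finset α) : Set α)).toNat + (M.eRk (I : Set α)).toNat then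
          ((M.eRk ((gr M \ I : Finset α) : Set α)).toNat).choose δ else 0)) ≤
        ∑ I ∈ (gr M).powerset, (if lo + δ ≤ (M.eRk ((gr M \ I : Finset α) : Set α)).toNat ∧
          (M.eRk ((gr M \ I : Finset α) : Set α)).toNat ≤ hi + δ then
          ((M.eRk ((gr M \ I : Finset α) : Set α)).toNat).choose δ else 0))
    (F : Finset α) (hF : 9 ≤ F.card)
    (h : Disjoint M.E (@Matroid.truncate α (Matroid.freeOn (F : Set α)) (PLDTruncate.freeOn_finite' F) 5).E) :
    haveI := PLDTruncate.freeOn_finite' F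
    haveI := PLDClosure.disjointSum_finite' _ _ h
    ∀ lo hi δ Θ : ℕ, Θ ≤ lo + hi + δ → (lo = 0 ∨ lo + hi + δ ≤ Θ) →
      (∑ I ∈ (gr (M.disjointSum (Matroid.truncate (Matroid.freeOn (F : Set α)) 5) h)).powerset, (if lo ≤ ((M.disjointSum (Matroid.truncate (Matroid.freeOn (F : Set α)) 5) h).eRk (I : Set α)).toNat ∧ ((M.disjointSum (Matroid.truncate (Matroid.freeOn (F : Set α)) 5) h).eRk (I : Set α)).toNat ≤ hi ∧
          Θ ≤ ((M.disjointSum (Matroid.truncate (Matroid.freeOn (F : Set α)) 5) h).eRk ((gr (M.disjointSum (Matroid.truncate (Matroid.freeOn (F : Set α)) 5) h) \ I : Finset α) : Set α)).toNat + ((M.disjointSum (Matroid.truncate (Matroid.freeOn (F : Set α)) 5) h).eRk (I : Set α)).toNat then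
          (((M.disjointSum (Matroid.truncate (Matroid.freeOn (F : Set α)) 5) h).eRk ((gr (M.disjointSum (Matroid.truncate (Matroid.freeOn (F : Set α)) 5) h) \ I : Finset α) : Set α)).toNat).choose δ else 0)) ≤
        ∑ I ∈ (gr (M.disjointSum (Matroid.truncate (Matroid.freeOn (F : Set α)) 5) h)).powerset, (if lo + δ ≤ ((M.disjointSum (Matroid.truncate (Matroid.freeOn (F : Set α)) 5) h).eRk ((gr (M.disjointSum (Matroid.truncate (Matroid.freeOn (F : Set α)) 5) h) \ I : Finset α) : Set α)).toNat ∧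
          ((M.disjointSum (Matroid.truncate (Matroid.freeOn (F : Set α)) 5) h).eRk ((gr (M.disjointSum (Matroid.truncate (Matroid.freeOn (F : Set α)) 5) h) \ I : Finset α) : Set α)).toNat ≤ hi + δ then
          (((M.disjointSum (Matroid.truncate (Matroid.freeOn (F : Set α)) 5) h).eRk ((gr (M.disjointSum (Matroid.truncate (Matroid.freeOn (F : Set α)) 5) h) \ I : Finset α) : Set α)).toNat).choose δ else 0) := by
  haveI := PLDTruncate.freeOn_finite' F
  haveI := PLDClosure.disjointSum_finite' _ _ h
  have hU : (Matroid.truncate (Matroid.freeOn (F : Set α)) 5).eRank ≤ ((5 : ℕ) : ℕ∞) := by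
    rw [Matroid.truncate_eRank]; exact min_le_right _ _
  have hr' : M.eRank ≤ ((5 : ℕ) : ℕ∞) := by exact_mod_cast hr
  have hb : ∀ I ∈ (gr (M.disjointSum (Matroid.truncate (Matroid.freeOn (F : Set α)) 5) h)).powerset,
      ((M.disjointSum (Matroid.truncate (Matroid.freeOn (F : Set α)) 5) h).eRk (I : Set α)).toNat ≤ 10 ∧ ((M.disjointSum (Matroid.truncate (Matroid.freeOn (F : Set α)) 5) h).eRk ((gr (M.disjointSum (Matroid.truncate (Matroid.freeOn (F : Set α)) 5) h) \ I : Finset α) : Set α)).toNat ≤ 10 := by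
    intro I _
    constructor
    · rw [PLDClosure.toNat_eRk_disjointSum]
      have h1 := PLDCert.toNat_eRk_le_of_eRank_le M hr' ((I ∩ gr M : Finset α) : Set α)
      have h2 := PLDCert.toNat_eRk_le_of_eRank_le _ hU ((I ∩ gr (Matroid.truncate (Matroid.freeOn (F : Set α)) 5) : Finset α) : Set α)
      omega
    · rw [PLDClosure.toNat_eRk_disjointSum]
      have h1 := PLDCert.toNat_eRk_le_of_eRank_le M hr' (((gr (M.disjointSum (Matroid.truncate (Matroid.freeOn (F : Set α)) 5) h) \ I) ∩ gr M : Finset α) : Set α)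
      have h2 := PLDCert.toNat_eRk_le_of_eRank_le _ hU (((gr (M.disjointSum (Matroid.truncate (Matroid.freeOn (F : Set α)) 5) h) \ I) ∩ gr (Matroid.truncate (Matroid.freeOn (F : Set α)) 5) : Finset α) : Set α)
      omega
  refine PLDSymCex.pld_of_bounded (gr (M.disjointSum (Matroid.truncate (Matroid.freeOn (F : Set α)) 5) h)).powerset (fun I : Finset α => ((M.disjointSum (Matroid.truncate (Matroid.freeOn (F : Set α)) 5) h).eRk (I : Set α)).toNat)
    (fun I : Finset α => ((M.disjointSum (Matroid.truncate (Matroid.freeOn (F : Set α)) 5) h).eRk ((gr (M.disjointSum (Matroid.truncate (Matroid.freeOn (F : Set α)) 5) h) \ I : Finset α) : Set α)).toNat) 10 hb ?_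
  intro lo hi δ hlh hhR hδR
  have hL := PLDClosure.sum_powerset_disjointSum M _ h
    (fun x f => if lo ≤ x ∧ x ≤ hi ∧ (if lo = 0 then 0 else lo + hi + δ) ≤ f + x then f.choose δ else 0)
  have hR := PLDClosure.sum_powerset_disjointSum M _ h
    (fun x f => if lo + δ ≤ f ∧ f ≤ hi + δ then f.choose δ else 0)
  beta_reduce at hL hR
  rw [hL, hR]
  have h2L : ∀ x₁ f₁ : ℕ,
      ∑ I₂ ∈ (gr (Matroid.truncate (Matroid.freeOn (F : Set α)) 5)).powerset,
        (if lo ≤ x₁ + ((Matroid.truncate (Matroid.freeOn (F : Set α)) 5).eRk (I₂ : Set α)).toNat ∧ x₁ + ((Matroid.truncate (Matroid.freeOn (F : Set α)) 5).eRk (I₂ : Set α)).toNat ≤ hi ∧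
            (if lo = 0 then 0 else lo + hi + δ) ≤ f₁ + ((Matroid.truncate (Matroid.freeOn (F : Set α)) 5).eRk ((gr (Matroid.truncate (Matroid.freeOn (F : Set α)) 5) \ I₂ : Finset α) : Set α)).toNat +
              (x₁ + ((Matroid.truncate (Matroid.freeOn (F : Set α)) 5).eRk (I₂ : Set α)).toNat) then
          (f₁ + ((Matroid.truncate (Matroid.freeOn (F : Set α)) 5).eRk ((gr (Matroid.truncate (Matroid.freeOn (F : Set α)) 5) \ I₂ : Finset α) : Set α)).toNat).choose δ else 0) =
      (∑ i ∈ range (F.card + 1), Nat.choose F.card i * (if lo ≤ x₁ + min i 5 ∧ x₁ + min i 5 ≤ hi ∧ (if lo = 0 then 0 else lo + hi + δ) ≤ (f₁ + min (F.card - i) 5) + (x₁ + min i 5) then (f₁ + min (F.card - i) 5).choose δ else 0)) := by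
    intro x₁ f₁
    have := PLDTruncate.sum_powerset_truncate_freeOn F 5
      (fun x₂ f₂ => if lo ≤ x₁ + x₂ ∧ x₁ + x₂ ≤ hi ∧ (if lo = 0 then 0 else lo + hi + δ) ≤ f₁ + f₂ + (x₁ + x₂) then
        (f₁ + f₂).choose δ else 0)
    beta_reduce at this
    exact this
  have h2R : ∀ f₁ : ℕ,
      ∑ I₂ ∈ (gr (Matroid.truncate (Matroid.freeOn (F : Set α)) 5)).powerset,
        (if lo + δ ≤ f₁ + ((Matroid.truncate (Matroid.freeOn (F : Set α)) 5).eRk ((gr (Matroid.truncate (Matroid.freeOn (F : Set α)) 5) \ I₂ : Finset α) : Set α)).toNat ∧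
            f₁ + ((Matroid.truncate (Matroid.freeOn (F : Set α)) 5).eRk ((gr (Matroid.truncate (Matroid.freeOn (F : Set α)) 5) \ I₂ : Finset α) : Set α)).toNat ≤ hi + δ then
          (f₁ + ((Matroid.truncate (Matroid.freeOn (F : Set α)) 5).eRk ((gr (Matroid.truncate (Matroid.freeOn (F : Set α)) 5) \ I₂ : Finset α) : Set α)).toNat).choose δ else 0) =
      (∑ i ∈ range (F.card + 1), Nat.choose F.card i * (if lo + δ ≤ f₁ + min (F.card - i) 5 ∧ f₁ + min (F.card - i) 5 ≤ hi + δ then (f₁ + min (F.card - i) 5).choose δ else 0)) := by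
    intro f₁
    have := PLDTruncate.sum_powerset_truncate_freeOn F 5
      (fun x₂ f₂ => if lo + δ ≤ f₁ + f₂ ∧ f₁ + f₂ ≤ hi + δ then (f₁ + f₂).choose δ else 0)
    beta_reduce at this
    exact this
  simp only [h2L, h2R]
  -- the case `m = 9` from the landed table
  obtain ⟨hDpos, hadm, hcert⟩ := PLDTriangle.uniform_5_9_table_5 _ rfl lo (mem_range.2 (by omega)) hi (mem_range.2 (by omega))
    δ (mem_range.2 (by omega)) hlh
  have key := PLDCert.sum_le_of_cert M hPLD 5 hr' _ hadm _ _ hcert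
  rw [← Finset.mul_sum, ← Finset.mul_sum] at key
  have h4 := Nat.le_of_mul_le_mul_left key hDpos
  -- the lift to `m = |F| ≥ 9`
  have hq := PLDPlaneTable.pld_conv_q51_of_eRank_le_5 M hr hPLD lo hi δ hlh hhR hδR
  have hq' := PLDPlaneTable.pld_conv_q52_of_eRank_le_5 M hr hPLD lo hi δ hlh hhR hδR
  have hq'' := PLDPlaneTable.pld_conv_q53_of_eRank_le_5 M hr hPLD lo hi δ hlh hhR hδR
  exact lift_instance_five (gr M).powerset (fun I : Finset α => (M.eRk (I : Set α)).toNat)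
    (fun I : Finset α => (M.eRk ((gr M \ I : Finset α) : Set α)).toNat) hPLD F.card hF lo hi δ
    (if lo = 0 then 0 else lo + hi + δ) (by split_ifs <;> omega) (by split_ifs <;> omega)
    (by simpa only [mul_add, add_assoc, one_mul] using hq) (by simpa only [mul_add, add_assoc, one_mul] using hq')
    (by simpa only [mul_add, add_assoc, one_mul] using hq'') h4

end PLDFiveLift

end PercRepro
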